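import Summits.ABC.StewartYu.PadicTwoValues
import Summits.ABC.StewartYu.DescentThirdQ
import Literature.NumberTheory.Transcendental.PadicCW77Functions
import HarnessLib

/-!
# Cell abc-stewartyu, W80Two (iv): the auxiliary functions `f_{J,τ}`, `φ_{J,τ}` of the `2`-adic
# set-up at BASE `3` — values at integers and at THIRD points, derivatives on `‖z‖ < 4`, Lemma 9

`Summits/ABC/StewartYu/PadicTwoFunctions.lean` — cell `abc-stewartyu` (seat lit; route
`PadicPrimesW80TwoThirds`, crux `W80Two` stmt-ABC-19486; planner decision D₃ 2026-08-26: triadic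
twins as new declarations).  Plain definitions and theorems; no named fact.  TWIN of
`PadicTwistFunctions.lean` (odd `p`, base `2`, disc `‖z‖ < √p`) for `S : TwoSetup` (`p = 2`,
generators `≡ 1 (mod 8)`, no twist):
* `wOf₃ J₀ J u = w_ρ(3^{J₀−J} X) ∈ ℚ₂[X]`, `Dw₃ τ₀ z` its `τ₀`-th derivative; `Dw₃_ratCast` /
  `Dw₃_natCast` / `Dw₃_third` give the tree's scale-generic rational value
  `PadicCW77.Setup.DwQ (3^{J₀−J}) …` (so an interface `qΔ₃ := DwQ (3^{J₀−J}) …` matches by `rfl`);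
* `termF`, `termΦ`, `F` (`f_{J,τ}`), `Φ` (`φ_{J,τ}`) on the cast `γ`-monomial `qA`;
* VALUES: `Φ_natCast` (at `s ∈ ℕ`: the rational core `∑ p(u)·DwQ·qA·qE`), **`Φ_third`** (at `s/3`:
  `Multicub.ev3 cbrt (classVec3 box p (DwQ(s/3)·qA) s)`, via `DescentThirdQ`) and the separation
  `classVec3_eq_zero_of_Φ_third_eq_zero` under cube-Kummer;
* ANALYSIS on `‖z‖ < 4` (`‖expo·z‖ < 2⁻¹`): `hasDerivAt_F` (`f'_τ = ∑ᵢ cᵢ f_{τ+eᵢ}`, `c₀ = 1`,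
  `cⱼ = log₂ αⱼ`), `contDiffAt_F`, `iteratedDeriv_F_succ`, `norm_iteratedDeriv_F_le_of_forall`;
* SIZES on `‖z‖ ≤ 2`: `norm_F_le`; Lemma 9 `norm_F_sub_Φ_le` (`‖f − φ‖ ≤ Q·2‖Λ₀‖` if `‖Λ₀‖ ≤ 8⁻¹`).

## References
* [Yu1990] K. Yu, *Linear forms in p-adic logarithms II*, Compositio Math. 74 (1990), §§1.1, 2.2–2.4, §3.
* [CijsouwWaldschmidt1977] P. L. Cijsouw, M. Waldschmidt, Compositio Math. 34 (1977), §4 (pp. 184–189).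
-/

noncomputable section

open NormedSpace Finset IsUltrametricDist Polynomial Metric
open Literature.NumberTheory.Transcendental
open Literature.NumberTheory.Transcendental.Baker1975 (bump bump_apply sum_bump)
open Literature.NumberTheory.Transcendental.PadicCW77.Setup (DwQ)
open scoped Nat Topology

namespace Summit.ABC.StewartYu

open Literature.NumberTheory.Transcendental.CW77.Setup (Idx Tau tauNorm bump0 bumpj bumpτ tauNorm_bumpτ bumpτ_zero bumpτ_succ)

namespace TwoSetup

variable (S : TwoSetup) {h Lb : ℕ}

/-! ### The `Δ`-polynomial at base `3` and its rational values -/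

/-- **The `Δ`-polynomial of `u` at level `J`, base `3`**: `w_ρ(3^{J₀−J} X) ∈ ℚ₂[X]`.
[cite: Yu1990, §3 (the q-descent, q = 3)] -/
def wOf₃ (J₀ J : ℕ) (u : Idx S.d h Lb) : ℚ_[2][X] :=
  (Waldschmidt1980.wScaled (3 ^ (J₀ - J)) (u.1.1 : ℕ) (u.1.2 : ℕ) h).map (algebraMap ℚ ℚ_[2])

/-- The `Δ`-factor `Dw₃ τ₀ z = (d/dz)^{τ₀} [w_ρ(3^{J₀−J} z)]`. [cite: CijsouwWaldschmidt1977, §4 (p. 186)] -/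
def Dw₃ (J₀ J : ℕ) (u : Idx S.d h Lb) (τ₀ : ℕ) (z : ℚ_[2]) : ℚ_[2] :=
  (derivative^[τ₀] (S.wOf₃ J₀ J u)).eval z

/-- **`Dw₃ τ₀ x = DwQ (3^{J₀−J}) … x`** at any RATIONAL point `x` (the integers and the third points
`s/3`). [cite: CijsouwWaldschmidt1977, §4 (9) (p. 184)] -/
theorem Dw₃_ratCast (J₀ J : ℕ) (u : Idx S.d h Lb) (τ₀ : ℕ) (x : ℚ) :
    S.Dw₃ J₀ J u τ₀ (x : ℚ_[2]) = (DwQ (3 ^ (J₀ - J)) (u.1.1 : ℕ) (u.1.2 : ℕ) h τ₀ x : ℚ_[2]) := by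
  unfold Dw₃ wOf₃ PadicCW77.Setup.DwQ
  rw [iterate_derivative_map, Polynomial.eval_map,
    show ((x : ℚ) : ℚ_[2]) = algebraMap ℚ ℚ_[2] x from rfl, Polynomial.eval₂_at_apply]
  rfl

/-- `Dw₃ τ₀ s = DwQ (3^{J₀−J}) … s` at a natural number `s`. [cite: CijsouwWaldschmidt1977, §4 (9) (p. 184)] -/
theorem Dw₃_natCast (J₀ J : ℕ) (u : Idx S.d h Lb) (τ₀ s : ℕ) :
    S.Dw₃ J₀ J u τ₀ (s : ℚ_[2]) = (DwQ (3 ^ (J₀ - J)) (u.1.1 : ℕ) (u.1.2 : ℕ) h τ₀ (s : ℚ) : ℚ_[2]) := by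
  rw [← S.Dw₃_ratCast]; norm_cast

/-- `Dw₃ τ₀ (s · 3⁻¹) = DwQ (3^{J₀−J}) … (s/3)` at a third point. [cite: Yu1990, §3] -/
theorem Dw₃_third (J₀ J : ℕ) (u : Idx S.d h Lb) (τ₀ s : ℕ) :
    S.Dw₃ J₀ J u τ₀ ((s : ℚ_[2]) * ((3 : ℕ) : ℚ_[2])⁻¹) =
      (DwQ (3 ^ (J₀ - J)) (u.1.1 : ℕ) (u.1.2 : ℕ) h τ₀ ((s : ℚ) / 3) : ℚ_[2]) := by
  rw [← S.Dw₃_ratCast]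
  congr 1
  push_cast
  rw [div_eq_mul_inv]

/-- `Dw₃` is differentiable with `deriv Dw₃ τ₀ = Dw₃ (τ₀+1)`. [cite: CijsouwWaldschmidt1977, §4 (pp. 186–188)] -/
theorem deriv_Dw₃ (J₀ J : ℕ) (u : Idx S.d h Lb) (τ₀ : ℕ) (z : ℚ_[2]) :
    DifferentiableAt ℚ_[2] (S.Dw₃ J₀ J u τ₀) z ∧ deriv (S.Dw₃ J₀ J u τ₀) z = S.Dw₃ J₀ J u (τ₀ + 1) z := by
  have hd : HasDerivAt (S.Dw₃ J₀ J u τ₀) (S.Dw₃ J₀ J u (τ₀ + 1) z) z := by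
    unfold Dw₃
    rw [Function.iterate_succ_apply']
    exact Polynomial.hasDerivAt _ z
  exact ⟨hd.differentiableAt, hd.deriv⟩

/-- `Dw₃` is smooth (a polynomial function) — over `ℚ₂`. [cite: CijsouwWaldschmidt1977, §4 (pp. 186–188)] -/
theorem contDiffAt_Dw₃ (J₀ J : ℕ) (u : Idx S.d h Lb) (τ₀ : ℕ) (n : WithTop ℕ∞) (z : ℚ_[2]) :
    ContDiffAt ℚ_[2] n (S.Dw₃ J₀ J u τ₀) z := by
  have hc := (Polynomial.contDiff_aeval (𝕜 := ℚ_[2]) (derivative^[τ₀] (S.wOf₃ J₀ J u)) n).contDiffAt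
    (x := z)
  have e : S.Dw₃ J₀ J u τ₀ = fun x : ℚ_[2] => Polynomial.aeval x (derivative^[τ₀] (S.wOf₃ J₀ J u)) := by
    funext x; unfold Dw₃; rw [Polynomial.coe_aeval_eq_eval]
  rw [e]; exact hc

/-! ### The functions -/

/-- `qA(u, τ' + eⱼ) = qA(u, τ') · γⱼ` in `ℚ₂`. [cite: CijsouwWaldschmidt1977, §4 (pp. 186–188)] -/
theorem qA_bump_cast (u : Idx S.d h Lb) (τ' : Fin S.d → ℕ) (j : Fin S.d) :
    (S.frame.qA u (bump τ' j) : ℚ_[2]) = (S.frame.qA u τ' : ℚ_[2]) * (S.frame.γ u j : ℚ_[2]) := by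
  unfold CW77.Setup.qA; push_cast
  simp_rw [bump_apply, pow_add, prod_mul_distrib]
  congr 1
  rw [Fintype.prod_eq_single j (fun j' hj' => by rw [if_neg hj', pow_zero]), if_pos rfl, pow_one]

/-- One term of `f_{J,τ}`: `Dw₃ τ₀ z · qA(u,τ') · exp(expo(u) z)`. [cite: CijsouwWaldschmidt1977, §4 (p. 186)] -/
def termF (J₀ J : ℕ) (u : Idx S.d h Lb) (τ : Tau S.d) (z : ℚ_[2]) : ℚ_[2] :=
  S.Dw₃ J₀ J u τ.1 z * (S.frame.qA u τ.2 : ℚ_[2]) * exp (S.expo u * z)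

/-- One term of `φ_{J,τ}`: the same with the exact exponent `ψ_u`. [cite: CijsouwWaldschmidt1977, §4 (p. 186)] -/
def termΦ (J₀ J : ℕ) (u : Idx S.d h Lb) (τ : Tau S.d) (z : ℚ_[2]) : ℚ_[2] :=
  S.Dw₃ J₀ J u τ.1 z * (S.frame.qA u τ.2 : ℚ_[2]) * exp (S.ψ u * z)

/-- **`f_{J,τ}(z) = ∑_{u ∈ box} p(u) · termF`**. [cite: CijsouwWaldschmidt1977, §4 (p. 186)] -/
def F (J₀ J : ℕ) (box : Finset (Idx S.d h Lb)) (pv : Idx S.d h Lb → ℤ) (τ : Tau S.d)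
    (z : ℚ_[2]) : ℚ_[2] :=
  ∑ u ∈ box, (pv u : ℚ_[2]) * S.termF J₀ J u τ z

/-- **`φ_{J,τ}(z) = ∑_{u ∈ box} p(u) · termΦ`**. [cite: CijsouwWaldschmidt1977, §4 (p. 186)] -/
def Φ (J₀ J : ℕ) (box : Finset (Idx S.d h Lb)) (pv : Idx S.d h Lb → ℤ) (τ : Tau S.d)
    (z : ℚ_[2]) : ℚ_[2] :=
  ∑ u ∈ box, (pv u : ℚ_[2]) * S.termΦ J₀ J u τ z

/-! ### The values of `φ` at the integers -/

/-- **`termΦ(s) = DwQ(s) · qA · qE(u,s)`** (rational) at a natural number `s`.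
[cite: CijsouwWaldschmidt1977, §4 (p. 186)] -/
theorem termΦ_natCast (J₀ J : ℕ) (u : Idx S.d h Lb) (τ : Tau S.d) (s : ℕ) :
    S.termΦ J₀ J u τ (s : ℚ_[2]) =
      ((DwQ (3 ^ (J₀ - J)) (u.1.1 : ℕ) (u.1.2 : ℕ) h τ.1 (s : ℚ) * S.frame.qA u τ.2 *
        S.toQ.qE u s : ℚ) : ℚ_[2]) := by
  unfold termΦ
  rw [S.Dw₃_natCast, S.exp_ψ_natCast]
  push_cast; ring

/-- **`φ_{J,τ}(s) = ∑_u p(u) · DwQ(s) qA qE(u,s)`** — the value at a natural number is RATIONAL.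
[cite: CijsouwWaldschmidt1977, §4 (p. 186)] -/
theorem Φ_natCast (J₀ J : ℕ) (box : Finset (Idx S.d h Lb)) (pv : Idx S.d h Lb → ℤ) (τ : Tau S.d)
    (s : ℕ) :
    S.Φ J₀ J box pv τ (s : ℚ_[2]) =
      ((∑ u ∈ box, (pv u : ℚ) * (DwQ (3 ^ (J₀ - J)) (u.1.1 : ℕ) (u.1.2 : ℕ) h τ.1 (s : ℚ) *
        S.frame.qA u τ.2 * S.toQ.qE u s) : ℚ) : ℚ_[2]) := by
  unfold Φ
  push_cast
  refine sum_congr rfl fun u _ => ?_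
  rw [S.termΦ_natCast]; push_cast; ring

/-! ### The values of `φ` at the third points -/

/-- **`termΦ(s/3) = (DwQ(s/3) · qA) · ∏ᵢ cbrtᵢ^{expnᵢ(u,s)}`**: at a third point the value of one
term is a rational multiple of a monomial in the principal cube roots. [cite: Yu1990, §3 (2.92)] -/
theorem termΦ_third (J₀ J : ℕ) (u : Idx S.d h Lb) (τ : Tau S.d) (s : ℕ) :
    S.termΦ J₀ J u τ ((s : ℚ_[2]) * ((3 : ℕ) : ℚ_[2])⁻¹) =
      ((DwQ (3 ^ (J₀ - J)) (u.1.1 : ℕ) (u.1.2 : ℕ) h τ.1 ((s : ℚ) / 3) * S.frame.qA u τ.2 : ℚ) :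
          ℚ_[2]) *
        ∏ i : Fin (S.d + 1), S.cbrt i ^ S.frame.expn u s i := by
  unfold termΦ
  rw [S.Dw₃_third, show S.ψ u * ((s : ℚ_[2]) * ((3 : ℕ) : ℚ_[2])⁻¹) =
    S.ψ u * (s : ℚ_[2]) * ((3 : ℕ) : ℚ_[2])⁻¹ by ring, S.exp_ψ_third_natCast]
  push_cast; ring

/-- **`φ_{J,τ}(s/3) = ev3 cbrt (classVec3 box p (DwQ(s/3)·qA) s)`**: the value at a third point is
the evaluation at the cube roots of the TRIADIC CLASS SUMS (lit's `DescentThirdQ`).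
[cite: Yu1990, §3 (2.93)–(2.95)] -/
theorem Φ_third (J₀ J : ℕ) (box : Finset (Idx S.d h Lb)) (pv : Idx S.d h Lb → ℤ) (τ : Tau S.d)
    (s : ℕ) :
    S.Φ J₀ J box pv τ ((s : ℚ_[2]) * ((3 : ℕ) : ℚ_[2])⁻¹) =
      Multicub.ev3 S.cbrt
        (S.toQ.classVec3 box pv
          (fun u => DwQ (3 ^ (J₀ - J)) (u.1.1 : ℕ) (u.1.2 : ℕ) h τ.1 ((s : ℚ) / 3) * S.frame.qA u τ.2) s) := by
  have ht : ∀ i, S.cbrt i ^ 3 = (S.toQ.all i : ℚ_[2]) := fun i => S.cbrt_pow_three i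
  rw [← S.toQ.sum_prod_cbrt_pow_eq_ev3 S.cbrt ht box pv _ s]
  unfold Φ
  refine sum_congr rfl fun u _ => ?_
  rw [S.termΦ_third]; ring

/-- **Separation at a third point**: under cube-Kummer, `φ_{J,τ}(s/3) = 0` forces every triadic class
sum of `p(u)·DwQ(s/3)·qA(u)·qEt(u,s)` to vanish. [cite: Yu1990, §3 (Lemma 2.5 for q = 3)] -/
theorem classVec3_eq_zero_of_Φ_third_eq_zero
    (hind : ∀ κ : Fin (S.d + 1) → ℕ, (∃ j, ¬ 3 ∣ κ j) → ∀ γ : ℚ, ∏ j, S.toQ.all j ^ κ j ≠ γ ^ 3)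
    (J₀ J : ℕ) (box : Finset (Idx S.d h Lb)) (pv : Idx S.d h Lb → ℤ) (τ : Tau S.d) (s : ℕ)
    (h0 : S.Φ J₀ J box pv τ ((s : ℚ_[2]) * ((3 : ℕ) : ℚ_[2])⁻¹) = 0) :
    S.toQ.classVec3 box pv
      (fun u => DwQ (3 ^ (J₀ - J)) (u.1.1 : ℕ) (u.1.2 : ℕ) h τ.1 ((s : ℚ) / 3) * S.frame.qA u τ.2) s = 0 := by
  rw [S.Φ_third] at h0
  exact S.toQ.classVec3_eq_zero_of_ev3_eq_zero hind S.cbrt (fun i => S.cbrt_pow_three i) box pv _ s h0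

/-! ### Analyticity and the differential equations on `‖z‖ < 4` -/

/-- `‖c z‖ < 2⁻¹` for `‖c‖ ≤ 8⁻¹`, `‖z‖ < 4`: the disc of convergence of `exp` at `ℓ = 2`.
[cite: Yu1990, §1.1] -/
theorem norm_mul_lt_half {c z : ℚ_[2]} (hc : ‖c‖ ≤ (8 : ℝ)⁻¹) (hz : ‖z‖ < 4) :
    ‖c * z‖ < ((2 : ℕ) : ℝ)⁻¹ := by
  rw [norm_mul]
  calc ‖c‖ * ‖z‖ ≤ (8 : ℝ)⁻¹ * ‖z‖ := mul_le_mul_of_nonneg_right hc (norm_nonneg _)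
    _ < (8 : ℝ)⁻¹ * 4 := mul_lt_mul_of_pos_left hz (by norm_num)
    _ = ((2 : ℕ) : ℝ)⁻¹ := by norm_num

/-- For `‖c‖ ≤ 8⁻¹`, `‖z‖ < 4`, `z • c` lies in the disc of convergence of `exp`. [cite: Yu1990, §1.1] -/
theorem mem_eball_of_norm_lt {c z : ℚ_[2]} (hc : ‖c‖ ≤ (8 : ℝ)⁻¹) (hz : ‖z‖ < 4) :
    z • c ∈ eball (0 : ℚ_[2]) (expSeries ℚ_[2] ℚ_[2]).radius :=
  PadicExp.mem_eball (ℓ := 2) (by rw [smul_eq_mul, mul_comm]; exact norm_mul_lt_half hc hz)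

/-- `d/dz exp(c z) = c exp(c z)` for `‖c‖ ≤ 8⁻¹`, `‖z‖ < 4`. [cite: Yu1990, §1.1] -/
theorem hasDerivAt_exp_mul {c z : ℚ_[2]} (hc : ‖c‖ ≤ (8 : ℝ)⁻¹) (hz : ‖z‖ < 4) :
    HasDerivAt (fun x : ℚ_[2] => exp (c * x)) (c * exp (c * z)) z := by
  have hd := hasDerivAt_exp_smul_const_of_mem_ball' (𝕂 := ℚ_[2]) c z (mem_eball_of_norm_lt hc hz)
  have e1 : (fun u : ℚ_[2] => exp (u • c)) = fun u : ℚ_[2] => exp (c * u) := by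
    funext u; rw [smul_eq_mul, mul_comm]
  rw [e1, smul_eq_mul, mul_comm z c] at hd
  exact hd

/-- `z ↦ exp(c z)` is analytic at `z` for `‖c‖ ≤ 8⁻¹`, `‖z‖ < 4`. [cite: Yu1990, §1.1] -/
theorem analyticAt_exp_mul {c z : ℚ_[2]} (hc : ‖c‖ ≤ (8 : ℝ)⁻¹) (hz : ‖z‖ < 4) :
    AnalyticAt ℚ_[2] (fun x : ℚ_[2] => exp (c * x)) z := by
  have h1 : AnalyticAt ℚ_[2] (exp : ℚ_[2] → ℚ_[2]) (c * z) := by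
    refine analyticAt_exp_of_mem_ball (c * z) ?_
    have := mem_eball_of_norm_lt hc hz
    rwa [smul_eq_mul, mul_comm] at this
  have h2 : AnalyticAt ℚ_[2] (fun x : ℚ_[2] => c * x) z := by fun_prop
  exact h1.comp h2

/-- **The derivative of one term**: `d/dz termF_τ = termF_{τ+e₀} + ∑ⱼ (log₂ αⱼ) · termF_{τ+eⱼ}`
on `‖z‖ < 4`. [cite: CijsouwWaldschmidt1977, §4 (p. 188), the differential equations] -/
theorem hasDerivAt_termF (J₀ J : ℕ) (u : Idx S.d h Lb) (τ : Tau S.d) {z : ℚ_[2]}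
    (hz : ‖z‖ < 4) :
    HasDerivAt (S.termF J₀ J u τ)
      (S.termF J₀ J u (bump0 τ) z + ∑ j : Fin S.d, S.lg j * S.termF J₀ J u (bumpj τ j) z) z := by
  have h1 : HasDerivAt (S.Dw₃ J₀ J u τ.1) (S.Dw₃ J₀ J u (τ.1 + 1) z) z := by
    unfold Dw₃
    rw [Function.iterate_succ_apply']
    exact Polynomial.hasDerivAt _ z
  have h2 : HasDerivAt (fun x => (S.frame.qA u τ.2 : ℚ_[2]) * exp (S.expo u * x))
      ((S.frame.qA u τ.2 : ℚ_[2]) * (S.expo u * exp (S.expo u * z))) z :=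
    (hasDerivAt_exp_mul (S.norm_expo_le u) hz).const_mul _
  have hsplit : S.termF J₀ J u τ =
      fun x => S.Dw₃ J₀ J u τ.1 x * ((S.frame.qA u τ.2 : ℚ_[2]) * exp (S.expo u * x)) := by
    funext x; simp only [termF]; ring
  rw [hsplit]
  refine (h1.mul h2).congr_deriv ?_
  have er : ∀ j : Fin S.d, S.lg j * S.termF J₀ J u (bumpj τ j) z =
      S.Dw₃ J₀ J u τ.1 z * ((S.frame.qA u τ.2 : ℚ_[2]) * exp (S.expo u * z)) *
        ((S.frame.γ u j : ℚ_[2]) * S.lg j) := by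
    intro j
    simp only [termF, bumpj]
    rw [S.qA_bump_cast]
    ring
  simp_rw [er]
  rw [← mul_sum, ← S.expo_eq]
  simp only [termF, bump0]
  ring

/-- The coefficients of the differential equation: `1` in the `Δ`-direction, `log₂ αⱼ` in the
direction of `αⱼ`. [cite: CijsouwWaldschmidt1977, §4 (p. 188)] -/
def dcoef (i : Fin (S.d + 1)) : ℚ_[2] := Fin.cases (1 : ℚ_[2]) (fun j => S.lg j) i

/-- `‖dcoef i‖ ≤ 1`, and `≤ 8⁻¹` in the directions of the generators. [folklore] -/
theorem norm_dcoef_le (i : Fin (S.d + 1)) :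
    ‖S.dcoef i‖ ≤ 1 ∧ (i ≠ 0 → ‖S.dcoef i‖ ≤ (8 : ℝ)⁻¹) := by
  refine Fin.cases ⟨by simp [dcoef], fun h => absurd rfl h⟩ (fun j => ?_) i
  exact ⟨(S.norm_lg_le j).trans (by norm_num), fun _ => S.norm_lg_le j⟩

/-- **`d/dz f_{J,τ} = ∑ᵢ cᵢ f_{J,τ+eᵢ}`** on `‖z‖ < 4`. [cite: CijsouwWaldschmidt1977, §4 (p. 188)] -/
theorem hasDerivAt_F (J₀ J : ℕ) (box : Finset (Idx S.d h Lb)) (pv : Idx S.d h Lb → ℤ)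
    (τ : Tau S.d) {z : ℚ_[2]} (hz : ‖z‖ < 4) :
    HasDerivAt (S.F J₀ J box pv τ)
      (∑ i : Fin (S.d + 1), S.dcoef i * S.F J₀ J box pv (bumpτ τ i) z) z := by
  unfold F
  have h := HasDerivAt.fun_sum fun u (_ : u ∈ box) =>
    (S.hasDerivAt_termF J₀ J u τ hz).const_mul (pv u : ℚ_[2])
  refine h.congr_deriv ?_
  have h0 : S.dcoef 0 = 1 := rfl
  have hs : ∀ j : Fin S.d, S.dcoef j.succ = S.lg j := fun j => rfl
  simp only [Fin.sum_univ_succ, h0, hs, one_mul, bumpτ_zero, bumpτ_succ, mul_add,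
    sum_add_distrib, mul_sum]
  congr 1
  rw [sum_comm]
  exact sum_congr rfl fun j _ => sum_congr rfl fun u _ => by ring

/-- `f_{J,τ}` is smooth at every point of the disc `‖z‖ < 4`. [cite: CijsouwWaldschmidt1977, §4 (pp. 186–188)] -/
theorem contDiffAt_F (J₀ J : ℕ) (box : Finset (Idx S.d h Lb)) (pv : Idx S.d h Lb → ℤ) (τ : Tau S.d)
    (n : WithTop ℕ∞) {z : ℚ_[2]} (hz : ‖z‖ < 4) :
    ContDiffAt ℚ_[2] n (S.F J₀ J box pv τ) z := by
  unfold F termF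
  refine ContDiffAt.sum fun u _ => contDiffAt_const.mul ?_
  exact ((S.contDiffAt_Dw₃ J₀ J u τ.1 n z).mul contDiffAt_const).mul
    (analyticAt_exp_mul (S.norm_expo_le u) hz).contDiffAt

/-- `deriv f_{J,τ} = ∑ᵢ cᵢ f_{J,τ+eᵢ}` near every point of `‖z‖ < 4`. [cite: CijsouwWaldschmidt1977, §4 (p. 188)] -/
theorem deriv_F_eventuallyEq (J₀ J : ℕ) (box : Finset (Idx S.d h Lb)) (pv : Idx S.d h Lb → ℤ)
    (τ : Tau S.d) {a : ℚ_[2]} (ha : ‖a‖ < 4) :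
    deriv (S.F J₀ J box pv τ) =ᶠ[𝓝 a]
      fun z => ∑ i : Fin (S.d + 1), S.dcoef i * S.F J₀ J box pv (bumpτ τ i) z := by
  have hball : {z : ℚ_[2] | ‖z‖ < 4} ∈ 𝓝 a := by
    have : {z : ℚ_[2] | ‖z‖ < 4} = Metric.ball 0 4 := by
      ext z; simp
    rw [this]
    exact Metric.isOpen_ball.mem_nhds (by simpa using ha)
  filter_upwards [hball] with z hz using (S.hasDerivAt_F J₀ J box pv τ hz).deriv

/-- **The iterated derivatives**: `f_τ^{(k+1)}(a) = ∑ᵢ cᵢ f_{τ+eᵢ}^{(k)}(a)` (`‖a‖ < 4`).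
[cite: CijsouwWaldschmidt1977, §4 (11) (p. 189)] -/
theorem iteratedDeriv_F_succ (J₀ J : ℕ) (box : Finset (Idx S.d h Lb)) (pv : Idx S.d h Lb → ℤ)
    (τ : Tau S.d) {a : ℚ_[2]} (ha : ‖a‖ < 4) (k : ℕ) :
    iteratedDeriv (k + 1) (S.F J₀ J box pv τ) a =
      ∑ i : Fin (S.d + 1), S.dcoef i * iteratedDeriv k (S.F J₀ J box pv (bumpτ τ i)) a := by
  rw [iteratedDeriv_succ', (S.deriv_F_eventuallyEq J₀ J box pv τ ha).iteratedDeriv_eq k,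
    iteratedDeriv_fun_sum fun i _ => contDiffAt_const.mul (S.contDiffAt_F J₀ J box pv (bumpτ τ i) k ha)]
  refine sum_congr rfl fun i _ => ?_
  exact iteratedDeriv_const_mul _ (S.contDiffAt_F J₀ J box pv (bumpτ τ i) k ha)

/-- **Derivatives are controlled by values, without loss** (ultrametric form of (10) ⇒ (11)):
if `‖f_{J,τ'}(a)‖ ≤ ε` whenever `|τ'| ≤ N`, then `‖f_{J,τ}^{(k)}(a)‖ ≤ ε` whenever `|τ| + k ≤ N`
(`‖a‖ < 4`; the coefficients `1, log₂ αⱼ` have norm `≤ 1`).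
[cite: CijsouwWaldschmidt1977, §4 (11) (p. 189)] [cite: Yu1990, Lemma 2.4] -/
theorem norm_iteratedDeriv_F_le_of_forall (J₀ J : ℕ) (box : Finset (Idx S.d h Lb))
    (pv : Idx S.d h Lb → ℤ) {a : ℚ_[2]} (ha : ‖a‖ < 4) (N : ℕ) {ε : ℝ} (hε0 : 0 ≤ ε)
    (hε : ∀ τ : Tau S.d, tauNorm τ ≤ N → ‖S.F J₀ J box pv τ a‖ ≤ ε) :
    ∀ (k : ℕ) (τ : Tau S.d), tauNorm τ + k ≤ N → ‖iteratedDeriv k (S.F J₀ J box pv τ) a‖ ≤ ε := by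
  intro k
  induction k with
  | zero => intro τ hτ; simpa using hε τ (by simpa using hτ)
  | succ k ih =>
    intro τ hτ
    rw [S.iteratedDeriv_F_succ J₀ J box pv τ ha k]
    refine IsUltrametricDist.norm_sum_le_of_forall_le_of_nonneg hε0 fun i _ => ?_
    rw [norm_mul]
    refine (mul_le_of_le_one_left (norm_nonneg _) (S.norm_dcoef_le i).1).trans (ih _ ?_)
    rw [tauNorm_bumpτ]; omega

/-! ### Sizes on the disc `‖z‖ ≤ 2`, and Lemma 9 -/

/-- On `‖z‖ ≤ 2` the exponential factors are units: `‖exp(c z)‖ = 1` for `‖c‖ ≤ 8⁻¹`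
(`‖c z‖ ≤ 4⁻¹ < 2⁻¹`). [cite: Yu1990, §1.1] -/
theorem norm_exp_mul_eq_one {c z : ℚ_[2]} (hc : ‖c‖ ≤ (8 : ℝ)⁻¹) (hz : ‖z‖ ≤ 2) :
    ‖exp (c * z)‖ = 1 :=
  PadicExp.norm_exp (ℓ := 2) (norm_mul_lt_half hc (lt_of_le_of_lt hz (by norm_num)))

/-- **Size of `f_{J,τ}` on `‖z‖ ≤ 2`**: `‖f_{J,τ}(z)‖ ≤ Q` if `‖Dw₃(u,τ₀,z)‖ ≤ Q` on the box
(`p(u) ∈ ℤ`, `‖qA‖ ≤ 1`, `‖exp(expo z)‖ = 1`). [cite: Yu1990, Lemma 2.2] -/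
theorem norm_F_le (J₀ J : ℕ) (box : Finset (Idx S.d h Lb)) (pv : Idx S.d h Lb → ℤ) (τ : Tau S.d)
    {z : ℚ_[2]} (hz : ‖z‖ ≤ 2) {Q : ℝ} (hQ0 : 0 ≤ Q)
    (hQ : ∀ u ∈ box, ‖S.Dw₃ J₀ J u τ.1 z‖ ≤ Q) : ‖S.F J₀ J box pv τ z‖ ≤ Q := by
  unfold F
  refine IsUltrametricDist.norm_sum_le_of_forall_le_of_nonneg hQ0 fun u hu => ?_
  rw [norm_mul, termF, norm_mul, norm_mul, norm_exp_mul_eq_one (S.norm_expo_le u) hz, mul_one]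
  calc ‖(pv u : ℚ_[2])‖ * (‖S.Dw₃ J₀ J u τ.1 z‖ * ‖(S.frame.qA u τ.2 : ℚ_[2])‖)
      ≤ 1 * (Q * 1) := by
        refine mul_le_mul (Padic.norm_int_le_one _) ?_ (by positivity) zero_le_one
        exact mul_le_mul (hQ u hu) (S.norm_qA_le u τ.2) (norm_nonneg _) hQ0
    _ = Q := by ring

/-- **Lemma 9, ultrametric, on `‖z‖ ≤ 2`**: if `‖Λ₀‖ ≤ 8⁻¹` then
`‖f_{J,τ}(z) − φ_{J,τ}(z)‖ ≤ Q · (2‖Λ₀‖)` (`Q ≥ ‖Dw₃‖` on the box), because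
`termF − termΦ = Dw₃ · qA · exp(ψ z) · (exp(λ_θ Λ₀ z) − 1)` and `‖exp w − 1‖ = ‖w‖ ≤ ‖z‖‖Λ₀‖ ≤ 2‖Λ₀‖`.
[cite: CijsouwWaldschmidt1977, §4 Lemma 9 (p. 187)] [cite: Yu1990, Lemma 2.3] -/
theorem norm_F_sub_Φ_le (J₀ J : ℕ) (box : Finset (Idx S.d h Lb)) (pv : Idx S.d h Lb → ℤ)
    (τ : Tau S.d) (hΛ : ‖S.Λ₀‖ ≤ (8 : ℝ)⁻¹) {z : ℚ_[2]} (hz : ‖z‖ ≤ 2) {Q : ℝ} (hQ0 : 0 ≤ Q)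
    (hQ : ∀ u ∈ box, ‖S.Dw₃ J₀ J u τ.1 z‖ ≤ Q) :
    ‖S.F J₀ J box pv τ z - S.Φ J₀ J box pv τ z‖ ≤ Q * (2 * ‖S.Λ₀‖) := by
  unfold F Φ
  rw [← sum_sub_distrib]
  refine IsUltrametricDist.norm_sum_le_of_forall_le_of_nonneg (by positivity) fun u hu => ?_
  have hz4 : ‖z‖ < 4 := lt_of_le_of_lt hz (by norm_num)
  have hψz : ‖S.ψ u * z‖ < ((2 : ℕ) : ℝ)⁻¹ := norm_mul_lt_half (S.norm_ψ_le u) hz4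
  have hδ : ‖(u.2.2 : ℚ_[2]) * S.Λ₀ * z‖ ≤ 2 * ‖S.Λ₀‖ := by
    rw [norm_mul]
    calc ‖(u.2.2 : ℚ_[2]) * S.Λ₀‖ * ‖z‖ ≤ ‖S.Λ₀‖ * 2 :=
          mul_le_mul (S.norm_natCast_mul_Λ₀_le _) hz (norm_nonneg _) (norm_nonneg _)
      _ = 2 * ‖S.Λ₀‖ := by ring
  have hδ' : ‖(u.2.2 : ℚ_[2]) * S.Λ₀ * z‖ < ((2 : ℕ) : ℝ)⁻¹ := by
    refine lt_of_le_of_lt hδ ?_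
    calc 2 * ‖S.Λ₀‖ ≤ 2 * (8 : ℝ)⁻¹ := mul_le_mul_of_nonneg_left hΛ (by norm_num)
      _ < ((2 : ℕ) : ℝ)⁻¹ := by norm_num
  have e : (pv u : ℚ_[2]) * S.termF J₀ J u τ z - (pv u : ℚ_[2]) * S.termΦ J₀ J u τ z =
      (pv u : ℚ_[2]) * (S.Dw₃ J₀ J u τ.1 z * (S.frame.qA u τ.2 : ℚ_[2]) * exp (S.ψ u * z)) *
        (exp ((u.2.2 : ℚ_[2]) * S.Λ₀ * z) - 1) := by
    simp only [termF, termΦ, expo]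
    rw [show (S.ψ u + (u.2.2 : ℚ_[2]) * S.Λ₀) * z = S.ψ u * z + (u.2.2 : ℚ_[2]) * S.Λ₀ * z by ring,
      PadicExp.exp_add (ℓ := 2) hψz hδ']
    ring
  rw [e, norm_mul, norm_mul, norm_mul, norm_mul, PadicExp.norm_exp (ℓ := 2) hψz, mul_one,
    PadicExp.norm_exp_sub_one (ℓ := 2) hδ']
  calc ‖(pv u : ℚ_[2])‖ * (‖S.Dw₃ J₀ J u τ.1 z‖ * ‖(S.frame.qA u τ.2 : ℚ_[2])‖) *
        ‖(u.2.2 : ℚ_[2]) * S.Λ₀ * z‖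
      ≤ 1 * (Q * 1) * (2 * ‖S.Λ₀‖) := by
        refine mul_le_mul ?_ hδ (norm_nonneg _) (by positivity)
        refine mul_le_mul (Padic.norm_int_le_one _) ?_ (by positivity) zero_le_one
        exact mul_le_mul (hQ u hu) (S.norm_qA_le u τ.2) (norm_nonneg _) hQ0
    _ = Q * (2 * ‖S.Λ₀‖) := by ring

end TwoSetup

end Summit.ABC.StewartYu

end
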